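import Mathlib.LinearAlgebra.Matrix.GeneralLinearGroup.FinTwo
import Literature.NumberTheory.Automorphic.GLnAdelicStructure
import Literature.NumberTheory.Automorphic.UnramifiedHeckeLevel
import Literature.NumberTheory.Automorphic.AdicCompletionCompact
import Literature.NumberTheory.Automorphic.StrongApproximationGL2
import HarnessLib

/-!
# Adelisation of classical modular forms, IV-a: the cosets of `U diag(ϖ, 1) U` in `GL₂(𝔸_K)`

Topic `NumberTheory/Automorphic`; first half of layer E-IV of the discharge plan of
`Literature.NumberTheory.Automorphic.Gelbart1975_exists_adelicNewform` (lang.S24), whose remaining named fact is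
`adelicLift_heckeEigenvalues` of `NewformAdelisationLift` (the Hecke eigenvalues of the adelic lift
`φ_f` of a newform). The trunk's Hecke operator `[U t U] = ∑_{yU ⊆ UtU} R(y)` (`heckeOperator`,
`heckeOperatorAt`) is evaluated on `U`-fixed vectors through *any* transversal of the `U`-orbit of
`tU` (`heckeOperator_apply_eq_sum` of `HeckeAlgebra`). This file produces that transversal for
`t = t_{v,1} = diag(ϖ, 1)_v` (`heckeDiagAt 2 K v ϖ 1`) and the levels used by the adelisation:

* **Local cosets** (Bump (1997), §4.6, (6.4), p. 494; Gelbart (1975), proof of Lemma 3.7, p. 31):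
  over a discretely valued field, `GL₂(𝒪) diag(ϖ,1) GL₂(𝒪) = ⊔ⱼ yⱼ GL₂(𝒪)` with
  `y_i = (ϖ b_i; 0 1)` (`b_i` residue representatives) and `y_∞ = (1 0; 0 ϖ)` (`heckeLocalRep`):
  completeness `exists_heckeLocalRep_inv_mul_mul_mem` (row reduction) and disjointness
  `heckeLocalRep_eq_of_inv_mul_mem`.
* **Adelic cosets** (`bijOn_ofLocal_heckeLocalRep`): for a level `U ≤ GL₂(𝔸_K)` containing the
  image of `GL₂(𝒪_v)`, with integral `v`-components, and stable under deleting the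
  `v`-component, the `ofLocal y_j` represent the `U`-orbit of `ofLocal diag(ϖ,1) · U`; and
  `t_{v,1} = ofLocal diag(ϖ, 1)` (`heckeDiagAt_two_one_eq_ofLocal`). The hypotheses hold for the
  principal congruence subgroup `K(𝔫)`, `v ∤ 𝔫` (`principalCongruenceLevel_local_hyps`) and for
  `{1_∞} × K₁(𝔫)` (`gammaOneLevel`, `gammaOneLevel_local_hyps`), the latter described place by
  place by `IsLocK1` (`mem_gammaOneFiniteLevel_iff_forall`).
* **Residues of `ℤ_p`** over `ℚ`: every `p`-adic integer is congruent to exactly one of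
  `0, …, p - 1` (`Rat.exists_valued_sub_algebraMap_natCast_lt_one`, `Rat.fin_eq_of_valued_sub_lt_one`).
* **A permutation lemma** (`sum_apply_mul_mul_eq_of_bijOn_cosets`): if the `y_j` represent the
  `U`-orbit of `tU` and `u ∈ U`, then `j ↦ (u y_j) U` is a permutation of the `y_j U`, so
  `∑ⱼ F(x u y_j) = ∑ⱼ F(x y_j)` for right-`U`-invariant `F` (Bump (1997), p. 47, the classical
  argument "the cosets are permuted").

Everything here is proved; no named facts.

## References

* D. Bump, *Automorphic forms and representations* (1997), §4.6, (6.4), p. 494; §3.6, p. 341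
  [Bump1997].
* S. Gelbart, *Automorphic forms on adele groups* (1975), §3.B, (3.15) and Lemma 3.7, p. 31
  [Gelbart1975].
-/

noncomputable section

open Matrix.GeneralLinearGroup NumberField IsDedekindDomain IsDedekindDomain.HeightOneSpectrum

namespace Literature.NumberTheory.Automorphic

/-! ### The `p + 1` cosets of `GL₂(𝒪) diag(ϖ, 1) GL₂(𝒪)` over a discretely valued field -/

section LocalCosets

variable {F : Type*} [Field F] [Valued F (WithZero (Multiplicative ℤ))]

/-- `GL₂(𝒪)`: the valued congruence subgroup of radius `1` (entries of `g`, `g⁻¹` of valuation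
`≤ 1`). Local notation for this file's computations. [folklore] -/
abbrev GL2Int (F : Type*) [Field F] [Valued F (WithZero (Multiplicative ℤ))] : Subgroup (GL (Fin 2) F) :=
  valuedCongruenceSubgroup (Fin 2) (1 : WithZero (Multiplicative ℤ))

omit [Valued F (WithZero (Multiplicative ℤ))] in
/-- A `2 × 2` invertible matrix from its entries and a unit determinant. [folklore] -/
theorem det_fin_two_val (g : GL (Fin 2) F) :
    g.det.val = (g : Matrix (Fin 2) (Fin 2) F) 0 0 * (g : Matrix (Fin 2) (Fin 2) F) 1 1 -
      (g : Matrix (Fin 2) (Fin 2) F) 0 1 * (g : Matrix (Fin 2) (Fin 2) F) 1 0 := by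
  rw [Matrix.GeneralLinearGroup.val_det_apply, Matrix.det_fin_two]

/-- Membership in `GL₂(𝒪)` from integral entries and a unit determinant: then `g⁻¹ = det⁻¹ adj g`
is integral too. [folklore] -/
theorem mem_GL2Int_of_entries {g : GL (Fin 2) F} (h : ∀ i j, Valued.v ((g : Matrix (Fin 2) (Fin 2) F) i j) ≤ 1)
    (hdet : Valued.v g.det.val = 1) : g ∈ GL2Int F := by
  refine ⟨h, fun i j => ?_, fun i j => ?_⟩
  · have hinv : ((g⁻¹ : GL (Fin 2) F) : Matrix (Fin 2) (Fin 2) F) =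
        g.det.val⁻¹ • Matrix.adjugate (g : Matrix (Fin 2) (Fin 2) F) := by
      rw [Matrix.coe_units_inv, Matrix.inv_def, Ring.inverse_eq_inv', Matrix.GeneralLinearGroup.val_det_apply]
    rw [hinv, Matrix.smul_apply, smul_eq_mul, Valuation.map_mul, map_inv₀, hdet, inv_one, one_mul,
      Matrix.adjugate_fin_two]
    fin_cases i <;> fin_cases j <;> simp [h]
  · rw [Matrix.sub_apply]
    refine (Valuation.map_sub _ _ _).trans (max_le (h i j) ?_)
    rw [Matrix.one_apply]; split_ifs <;> simp

/-- In `GL₂(𝒪)` the determinant is a unit: `|det g| = 1`. [folklore] -/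
theorem valuation_det_eq_one_of_mem {g : GL (Fin 2) F} (hg : g ∈ GL2Int F) : Valued.v g.det.val = 1 := by
  obtain ⟨h1, h2, -⟩ := hg
  have hle : ∀ (M : Matrix (Fin 2) (Fin 2) F), (∀ i j, Valued.v (M i j) ≤ 1) → Valued.v M.det ≤ 1 := by
    intro M hM
    rw [Matrix.det_fin_two]
    refine (Valuation.map_sub _ _ _).trans (max_le ?_ ?_) <;> rw [Valuation.map_mul] <;>
      exact mul_le_one' (hM _ _) (hM _ _)
  have hg1 := hle _ h1
  have hg2 := hle _ h2
  rw [← Matrix.GeneralLinearGroup.val_det_apply] at hg1 hg2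
  rw [map_inv, Units.val_inv_eq_inv_val, map_inv₀] at hg2
  have hne : Valued.v g.det.val ≠ 0 := (Valuation.ne_zero_iff _).2 g.det.ne_zero
  exact le_antisymm hg1 (by rwa [inv_le_one₀ (zero_lt_iff.2 hne)] at hg2)

/-- In a discretely valued field, `|x| < 1` implies `|x| ≤ |ϖ|` for a uniformizer `ϖ`
(`|ϖ| = exp(-1)`). [folklore] -/
theorem valuation_le_of_lt_one {ϖ : F} (hϖ : Valued.v ϖ = WithZero.exp (-1 : ℤ)) {x : F}
    (hx : Valued.v x < 1) : Valued.v x ≤ Valued.v ϖ := by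
  rw [hϖ]
  by_cases h0 : Valued.v x = 0
  · rw [h0]; exact zero_le
  · rw [← WithZero.exp_log h0] at hx ⊢
    rw [← WithZero.exp_zero, WithZero.exp_lt_exp] at hx
    rw [WithZero.exp_le_exp]
    omega

variable (ϖ : F) {ι : Type*} (b : ι → F)

/-- The representatives of `GL₂(𝒪) diag(ϖ, 1) GL₂(𝒪) / GL₂(𝒪)`: `y_i = (ϖ b_i; 0 1)` for `i ∈ ι`
(`b` a system of residue representatives) and `y_∞ = (1 0; 0 ϖ)` (Bump (1997), §4.6, (6.4),
p. 494: `K diag(ϖ,1) K = diag(1,ϖ) K ∪ ⋃_{b mod 𝔭} (ϖ b; 0 1) K` (disjoint); Gelbart (1975), proof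
of Lemma 3.7, p. 31, with `b ↦ -b`). [cite: Bump1997, §4.6, (6.4), p. 494] -/
def heckeLocalRep (hϖ : ϖ ≠ 0) : Option ι → GL (Fin 2) F
  | some i => ⟨!![ϖ, b i; 0, 1], !![ϖ⁻¹, -(ϖ⁻¹ * b i); 0, 1],
      by ext r c; fin_cases r <;> fin_cases c <;> simp [Matrix.mul_apply, Fin.sum_univ_two, hϖ],
      by ext r c; fin_cases r <;> fin_cases c <;> simp [Matrix.mul_apply, Fin.sum_univ_two, hϖ]⟩
  | none => ⟨!![1, 0; 0, ϖ], !![1, 0; 0, ϖ⁻¹],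
      by ext r c; fin_cases r <;> fin_cases c <;> simp [Matrix.mul_apply, Fin.sum_univ_two, hϖ],
      by ext r c; fin_cases r <;> fin_cases c <;> simp [Matrix.mul_apply, Fin.sum_univ_two, hϖ]⟩

/-- The Hecke element `diag(ϖ, 1) ∈ GL₂(F)`. [folklore] -/
def heckeLocalDiag (hϖ : ϖ ≠ 0) : GL (Fin 2) F :=
  ⟨!![ϖ, 0; 0, 1], !![ϖ⁻¹, 0; 0, 1],
    by ext r c; fin_cases r <;> fin_cases c <;> simp [Matrix.mul_apply, Fin.sum_univ_two, hϖ],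
    by ext r c; fin_cases r <;> fin_cases c <;> simp [Matrix.mul_apply, Fin.sum_univ_two, hϖ]⟩

end LocalCosets

end Literature.NumberTheory.Automorphic

namespace Literature.NumberTheory.Automorphic

section LocalCosets2

variable {F : Type*} [Field F]
variable (ϖ : F) {ι : Type*} (b : ι → F) (hϖ0 : ϖ ≠ 0)

/-- Entries of `y_i = (ϖ b_i; 0 1)`. [folklore] -/
@[simp]
theorem coe_heckeLocalRep_some (i : ι) :
    ((heckeLocalRep ϖ b hϖ0 (some i) : GL (Fin 2) F) : Matrix (Fin 2) (Fin 2) F) = !![ϖ, b i; 0, 1] := rfl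

/-- Entries of `y_i⁻¹ = (ϖ⁻¹ -ϖ⁻¹b_i; 0 1)`. [folklore] -/
@[simp]
theorem coe_heckeLocalRep_some_inv (i : ι) :
    (((heckeLocalRep ϖ b hϖ0 (some i))⁻¹ : GL (Fin 2) F) : Matrix (Fin 2) (Fin 2) F) =
      !![ϖ⁻¹, -(ϖ⁻¹ * b i); 0, 1] := rfl

/-- Entries of `y_∞ = (1 0; 0 ϖ)`. [folklore] -/
@[simp]
theorem coe_heckeLocalRep_none :
    ((heckeLocalRep ϖ b hϖ0 none : GL (Fin 2) F) : Matrix (Fin 2) (Fin 2) F) = !![1, 0; 0, ϖ] := rfl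

/-- Entries of `y_∞⁻¹ = (1 0; 0 ϖ⁻¹)`. [folklore] -/
@[simp]
theorem coe_heckeLocalRep_none_inv :
    (((heckeLocalRep ϖ b hϖ0 none)⁻¹ : GL (Fin 2) F) : Matrix (Fin 2) (Fin 2) F) = !![1, 0; 0, ϖ⁻¹] := rfl

/-- Entries of `diag(ϖ, 1)`. [folklore] -/
@[simp]
theorem coe_heckeLocalDiag : ((heckeLocalDiag ϖ hϖ0 : GL (Fin 2) F) : Matrix (Fin 2) (Fin 2) F) = !![ϖ, 0; 0, 1] := rfl

/-- Entries of `diag(ϖ, 1)⁻¹`. [folklore] -/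
@[simp]
theorem coe_heckeLocalDiag_inv :
    (((heckeLocalDiag ϖ hϖ0)⁻¹ : GL (Fin 2) F) : Matrix (Fin 2) (Fin 2) F) = !![ϖ⁻¹, 0; 0, 1] := rfl

/-- `det y_j = ϖ`. [folklore] -/
theorem val_det_heckeLocalRep (j : Option ι) : (heckeLocalRep ϖ b hϖ0 j).det.val = ϖ := by
  cases j <;> simp

/-- `det diag(ϖ, 1) = ϖ`. [folklore] -/
theorem val_det_heckeLocalDiag : (heckeLocalDiag ϖ hϖ0).det.val = ϖ := by
  simp

variable [Valued F (WithZero (Multiplicative ℤ))]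

/-- `(1 x; 0 1) ∈ GL₂(𝒪)` for `|x| ≤ 1`. [folklore] -/
theorem upperRightHom_mem_GL2Int {x : F} (hx : Valued.v x ≤ 1) : (upperRightHom x : GL (Fin 2) F) ∈ GL2Int F := by
  refine mem_GL2Int_of_entries (fun i j => ?_) ?_
  · rw [show ((upperRightHom x : GL (Fin 2) F) : Matrix (Fin 2) (Fin 2) F) = !![1, x; 0, 1] from by
      rw [upperRightHom_apply]]
    fin_cases i <;> fin_cases j <;> simp [hx]
  · rw [det_fin_two_val]
    simp [upperRightHom_apply]

omit [Valued F (WithZero (Multiplicative ℤ))] in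
/-- `y_i = n(b_i) diag(ϖ, 1)`. [folklore] -/
theorem heckeLocalRep_some_eq (i : ι) :
    heckeLocalRep ϖ b hϖ0 (some i) = upperRightHom (b i) * heckeLocalDiag ϖ hϖ0 := by
  ext r c
  rw [Units.val_mul, coe_heckeLocalRep_some, coe_heckeLocalDiag, upperRightHom_apply]
  fin_cases r <;> fin_cases c <;> simp [Matrix.mul_apply, Fin.sum_univ_two]

/-- The Weyl element `w = (0 1; 1 0)`. [folklore] -/
def swapGL : GL (Fin 2) F :=
  ⟨!![0, 1; 1, 0], !![0, 1; 1, 0],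
    by ext r c; fin_cases r <;> fin_cases c <;> simp [Matrix.mul_apply, Fin.sum_univ_two],
    by ext r c; fin_cases r <;> fin_cases c <;> simp [Matrix.mul_apply, Fin.sum_univ_two]⟩

/-- `w ∈ GL₂(𝒪)`. [folklore] -/
theorem swapGL_mem_GL2Int : (swapGL : GL (Fin 2) F) ∈ GL2Int F := by
  refine mem_GL2Int_of_entries (fun i j => ?_) ?_
  · change Valued.v ((!![(0 : F), 1; 1, 0] : Matrix (Fin 2) (Fin 2) F) i j) ≤ 1
    fin_cases i <;> fin_cases j <;> simp
  · rw [det_fin_two_val]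
    change Valued.v ((0 : F) * 0 - 1 * 1) = 1
    simp

omit [Valued F (WithZero (Multiplicative ℤ))] in
/-- `y_∞ = w diag(ϖ, 1) w⁻¹`. [folklore] -/
theorem heckeLocalRep_none_eq :
    heckeLocalRep ϖ b hϖ0 none = swapGL * heckeLocalDiag ϖ hϖ0 * swapGL⁻¹ := by
  ext r c
  rw [Units.val_mul, Units.val_mul, coe_heckeLocalRep_none, coe_heckeLocalDiag]
  change _ = ((!![(0 : F), 1; 1, 0] * !![ϖ, 0; 0, 1] * !![(0 : F), 1; 1, 0]) : Matrix (Fin 2) (Fin 2) F) r c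
  fin_cases r <;> fin_cases c <;> simp [Matrix.mul_apply, Fin.sum_univ_two]

/-- **Distinctness of the representatives**: `y_i⁻¹ y_j ∈ GL₂(𝒪)` forces `i = j`, provided the
`b_i` are pairwise incongruent mod `ϖ` (and `|ϖ| = exp(-1)`) — the word "disjoint" in Bump (1997),
(6.4), p. 494. [cite: Bump1997, §4.6, (6.4), p. 494] -/
theorem heckeLocalRep_eq_of_inv_mul_mem (hϖ : Valued.v ϖ = WithZero.exp (-1 : ℤ))
    (hbinj : ∀ i j, Valued.v (b i - b j) < 1 → i = j) {i j : Option ι}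
    (h : (heckeLocalRep ϖ b hϖ0 i)⁻¹ * heckeLocalRep ϖ b hϖ0 j ∈ GL2Int F) : i = j := by
  have hϖinv : ¬ (Valued.v ϖ)⁻¹ ≤ 1 := by
    rw [hϖ, ← WithZero.exp_neg, neg_neg, ← WithZero.exp_zero, WithZero.exp_le_exp]
    omega
  obtain ⟨h1, -, -⟩ := h
  cases i with
  | none =>
    cases j with
    | none => rfl
    | some j =>
      exfalso
      have := h1 1 1
      rw [Units.val_mul, coe_heckeLocalRep_none_inv, coe_heckeLocalRep_some] at this
      simp [Matrix.mul_apply, Fin.sum_univ_two] at this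
      exact hϖinv this
  | some i =>
    cases j with
    | none =>
      exfalso
      have := h1 0 0
      rw [Units.val_mul, coe_heckeLocalRep_some_inv, coe_heckeLocalRep_none] at this
      simp [Matrix.mul_apply, Fin.sum_univ_two] at this
      exact hϖinv this
    | some j =>
      have := h1 0 1
      rw [Units.val_mul, coe_heckeLocalRep_some_inv, coe_heckeLocalRep_some] at this
      simp only [Matrix.mul_apply, Fin.sum_univ_two, Matrix.of_apply, Matrix.cons_val', Matrix.cons_val_zero,
        Matrix.cons_val_one, Matrix.empty_val', Matrix.cons_val_fin_one] at this
      have e : ϖ⁻¹ * b j + -(ϖ⁻¹ * b i) * 1 = ϖ⁻¹ * (b j - b i) := by ring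
      rw [e, Valuation.map_mul, map_inv₀, hϖ] at this
      have hlt : Valued.v (b j - b i) < 1 := by
        by_contra hge
        push Not at hge
        have : (WithZero.exp (-1 : ℤ))⁻¹ * 1 ≤ (WithZero.exp (-1 : ℤ))⁻¹ * Valued.v (b j - b i) :=
          mul_le_mul_right hge _
        rw [mul_one] at this
        have h2 : (WithZero.exp (-1 : ℤ))⁻¹ ≤ 1 := this.trans ‹_›
        rw [← WithZero.exp_neg, neg_neg, ← WithZero.exp_zero, WithZero.exp_le_exp] at h2
        omega
      rw [hbinj j i hlt]

/-- **Completeness of the representatives** (the row reduction behind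
`GL₂(𝒪) diag(ϖ,1) GL₂(𝒪) = ⊔ⱼ yⱼ GL₂(𝒪)`): for `k = (a b; c d) ∈ GL₂(𝒪)` there is `j` with
`y_j⁻¹ k diag(ϖ, 1) ∈ GL₂(𝒪)` — if `|d| = 1` take `j = i` with `b_i ≡ b/d (mod ϖ)`, giving
`(a - b_i c, (b - b_i d)/ϖ; cϖ, d)`; if `|d| < 1` take `j = ∞`, giving `(aϖ, b; c, d/ϖ)`
(the row reduction behind Bump (1997), (6.4), p. 494 / Exercise 4.6.1). [cite: Bump1997, §4.6, (6.4), p. 494] -/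
theorem exists_heckeLocalRep_inv_mul_mul_mem (hϖ : Valued.v ϖ = WithZero.exp (-1 : ℤ))
    (hbint : ∀ i, Valued.v (b i) ≤ 1) (hb : ∀ x : F, Valued.v x ≤ 1 → ∃ i, Valued.v (x - b i) < 1)
    {k : GL (Fin 2) F} (hk : k ∈ GL2Int F) :
    ∃ j, (heckeLocalRep ϖ b hϖ0 j)⁻¹ * k * heckeLocalDiag ϖ hϖ0 ∈ GL2Int F := by
  have hϖ1 : Valued.v ϖ ≤ 1 := by
    rw [hϖ, ← WithZero.exp_zero, WithZero.exp_le_exp]; omega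
  have hvϖ : Valued.v ϖ ≠ 0 := (Valuation.ne_zero_iff _).2 hϖ0
  obtain ⟨hk1, -, -⟩ := id hk
  have hdetk := valuation_det_eq_one_of_mem hk
  set a := (k : Matrix (Fin 2) (Fin 2) F) 0 0 with ha
  set b' := (k : Matrix (Fin 2) (Fin 2) F) 0 1 with hb'
  set c := (k : Matrix (Fin 2) (Fin 2) F) 1 0 with hc
  set d := (k : Matrix (Fin 2) (Fin 2) F) 1 1 with hd
  have hkmat : (k : Matrix (Fin 2) (Fin 2) F) = !![a, b'; c, d] := by
    ext r s; fin_cases r <;> fin_cases s <;> rfl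
  -- determinants
  have hdet : ∀ j, Valued.v ((heckeLocalRep ϖ b hϖ0 j)⁻¹ * k * heckeLocalDiag ϖ hϖ0).det.val = 1 := fun j => by
    rw [map_mul, map_mul, map_inv, Units.val_mul, Units.val_mul, Units.val_inv_eq_inv_val, val_det_heckeLocalRep,
      val_det_heckeLocalDiag, Valuation.map_mul, Valuation.map_mul, map_inv₀, hdetk, mul_one, inv_mul_cancel₀ hvϖ]
  rcases (hk1 1 1).lt_or_eq with hdlt | hdeq
  · -- `|d| < 1`: `j = ∞`
    have hprod : (((heckeLocalRep ϖ b hϖ0 none)⁻¹ * k * heckeLocalDiag ϖ hϖ0 : GL (Fin 2) F) :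
        Matrix (Fin 2) (Fin 2) F) = !![a * ϖ, b'; c, ϖ⁻¹ * d] := by
      rw [Units.val_mul, Units.val_mul, coe_heckeLocalRep_none_inv, coe_heckeLocalDiag, hkmat]
      ext r s
      fin_cases r <;> fin_cases s <;> simp [Matrix.mul_apply, Fin.sum_univ_two]
      field_simp
    refine ⟨none, mem_GL2Int_of_entries (fun r s => ?_) (hdet none)⟩
    have hdϖ : Valued.v (ϖ⁻¹ * d) ≤ 1 := by
      rw [Valuation.map_mul, map_inv₀]
      have := valuation_le_of_lt_one hϖ hdlt
      calc (Valued.v ϖ)⁻¹ * Valued.v d ≤ (Valued.v ϖ)⁻¹ * Valued.v ϖ := mul_le_mul_right this _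
        _ = 1 := inv_mul_cancel₀ hvϖ
    rw [hprod]
    fin_cases r <;> fin_cases s
    · simpa using mul_le_one' (hk1 0 0) hϖ1
    · simpa using hk1 0 1
    · simpa using hk1 1 0
    · simpa using hdϖ
  · -- `|d| = 1`: `j = some i` with `b_i ≡ b/d`
    have hd0 : d ≠ 0 := fun h => by
      have h' : Valued.v d = 1 := hdeq
      rw [h, Valuation.map_zero] at h'; exact zero_ne_one h'
    obtain ⟨i, hi⟩ := hb (b' * d⁻¹) (by rw [Valuation.map_mul, map_inv₀, hdeq, inv_one, mul_one]; exact hk1 0 1)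
    have hprod : (((heckeLocalRep ϖ b hϖ0 (some i))⁻¹ * k * heckeLocalDiag ϖ hϖ0 : GL (Fin 2) F) :
        Matrix (Fin 2) (Fin 2) F) = !![a - b i * c, ϖ⁻¹ * (b' - b i * d); c * ϖ, d] := by
      rw [Units.val_mul, Units.val_mul, coe_heckeLocalRep_some_inv, coe_heckeLocalDiag, hkmat]
      ext r s
      fin_cases r <;> fin_cases s <;> simp [Matrix.mul_apply, Fin.sum_univ_two] <;> field_simp <;> ring
    refine ⟨some i, mem_GL2Int_of_entries (fun r s => ?_) (hdet (some i))⟩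
    have hsmall : Valued.v (ϖ⁻¹ * (b' - b i * d)) ≤ 1 := by
      have e : b' - b i * d = (b' * d⁻¹ - b i) * d := by field_simp
      rw [Valuation.map_mul, map_inv₀, e, Valuation.map_mul, hdeq, mul_one]
      have := valuation_le_of_lt_one hϖ hi
      calc (Valued.v ϖ)⁻¹ * Valued.v (b' * d⁻¹ - b i) ≤ (Valued.v ϖ)⁻¹ * Valued.v ϖ := mul_le_mul_right this _
        _ = 1 := inv_mul_cancel₀ hvϖ
    have h00 : Valued.v (a - b i * c) ≤ 1 := by
      refine (Valuation.map_sub _ _ _).trans (max_le (hk1 0 0) ?_)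
      rw [Valuation.map_mul]; exact mul_le_one' (hbint i) (hk1 1 0)
    rw [hprod]
    fin_cases r <;> fin_cases s
    · simpa using h00
    · simpa using hsmall
    · simpa using mul_le_one' (hk1 1 0) hϖ1
    · simpa using hk1 1 1

end LocalCosets2

end Literature.NumberTheory.Automorphic

namespace Literature.NumberTheory.Automorphic

/-! ### From local to adelic: the cosets of `U t_{v,1} U` in `GL₂(𝔸_K)` -/

section GlobalCosets

variable {K : Type} [Field K] [NumberField K] {v : HeightOneSpectrum (𝓞 K)}

/-- Two elements of `GL_n(𝔸_K)` with the same archimedean part and the same components at all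
finite places are equal. [folklore] -/
theorem GLn.ext_of_fstHom_of_forall_map_adeleEval {n : ℕ} {x y : GL (Fin n) (AdeleRing (𝓞 K) K)}
    (h₁ : GLn.fstHom n K x = GLn.fstHom n K y)
    (h₂ : ∀ w : HeightOneSpectrum (𝓞 K), Matrix.GeneralLinearGroup.map (AdelicGroupData.adeleEval K w) x =
      Matrix.GeneralLinearGroup.map (AdelicGroupData.adeleEval K w) y) :
    x = y := by
  refine Matrix.GeneralLinearGroup.ext fun i j => Prod.ext ?_ ?_
  · exact (Matrix.GeneralLinearGroup.ext_iff _ _).mp h₁ i j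
  · refine RestrictedProduct.ext _ _ fun w => ?_
    have := (Matrix.GeneralLinearGroup.ext_iff _ _).mp (h₂ w) i j
    rwa [AdelicGroupData.coe_map_adeleEval_apply, AdelicGroupData.coe_map_adeleEval_apply,
      AdelicGroupData.adeleEval_apply, AdelicGroupData.adeleEval_apply] at this

/-- The archimedean part of `GLn.ofLocal g` is `1`. [folklore] -/
private theorem GLn.fstHom_ofLocal {n : ℕ} (g : GL (Fin n) (v.adicCompletion K)) : GLn.fstHom n K (GLn.ofLocal n K v g) = 1 :=
  Matrix.GeneralLinearGroup.ext fun i j => by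
    change ((GLn.ofLocal n K v g : Matrix (Fin n) (Fin n) (AdeleRing (𝓞 K) K)) i j).1 = _
    rw [GLn.fst_coe_ofLocal_apply, Units.val_one]

/-- The `w`-component, `w ≠ v`, of `GLn.ofLocal g` is `1`. [folklore] -/
theorem GLn.map_adeleEval_ofLocal_of_ne {n : ℕ} {w : HeightOneSpectrum (𝓞 K)} (h : w ≠ v)
    (g : GL (Fin n) (v.adicCompletion K)) :
    Matrix.GeneralLinearGroup.map (AdelicGroupData.adeleEval K w) (GLn.ofLocal n K v g) = 1 :=
  GLn.toLocal_ofLocal_of_ne h g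

variable {U : Subgroup (GL (Fin 2) (AdeleRing (𝓞 K) K))}
  (hU1 : (valuedCongruenceSubgroup (Fin 2) (1 : WithZero (Multiplicative ℤ))).map (GLn.ofLocal 2 K v) ≤ U)
  (hU2 : ∀ u ∈ U, Matrix.GeneralLinearGroup.map (AdelicGroupData.adeleEval K v) u ∈
    valuedCongruenceSubgroup (Fin 2) (1 : WithZero (Multiplicative ℤ)))
  (hU3 : ∀ u ∈ U, u * (GLn.ofLocal 2 K v (Matrix.GeneralLinearGroup.map (AdelicGroupData.adeleEval K v) u))⁻¹ ∈ U)
  {ϖ : v.adicCompletion K} (hϖ0 : ϖ ≠ 0) (hϖ : Valued.v ϖ = WithZero.exp (-1 : ℤ))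
  {ι : Type*} (b : ι → v.adicCompletion K)
  (hb : ∀ x : v.adicCompletion K, Valued.v x ≤ 1 → ∃ i, Valued.v (x - b i) < 1)
  (hbinj : ∀ i j, Valued.v (b i - b j) < 1 → i = j)

include hU1 in
/-- The adelic representatives `ofLocal y_j` lie in the orbit `U · (t U)`, `t = ofLocal diag(ϖ,1)`:
`y_i = n(b_i) t` with `n(b_i) ∈ GL₂(𝒪_v) ↪ U`, and `y_∞ = w t w⁻¹`, `w ∈ GL₂(𝒪_v)`. [folklore] -/
theorem ofLocal_heckeLocalRep_mem_orbit (hbint : ∀ i, Valued.v (b i) ≤ 1) (j : Option ι) :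
    ((GLn.ofLocal 2 K v (heckeLocalRep ϖ b hϖ0 j) : GL (Fin 2) (AdeleRing (𝓞 K) K)) :
        GL (Fin 2) (AdeleRing (𝓞 K) K) ⧸ U) ∈
      MulAction.orbit U ((GLn.ofLocal 2 K v (heckeLocalDiag ϖ hϖ0) : GL (Fin 2) (AdeleRing (𝓞 K) K)) :
        GL (Fin 2) (AdeleRing (𝓞 K) K) ⧸ U) := by
  cases j with
  | some i =>
    refine ⟨⟨GLn.ofLocal 2 K v (upperRightHom (b i)), hU1 ⟨_, upperRightHom_mem_GL2Int (hbint i), rfl⟩⟩, ?_⟩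
    change (((GLn.ofLocal 2 K v (upperRightHom (b i)) * GLn.ofLocal 2 K v (heckeLocalDiag ϖ hϖ0) :
      GL (Fin 2) (AdeleRing (𝓞 K) K)) : GL (Fin 2) (AdeleRing (𝓞 K) K) ⧸ U)) = _
    rw [← map_mul, ← heckeLocalRep_some_eq]
  | none =>
    refine ⟨⟨GLn.ofLocal 2 K v swapGL, hU1 ⟨_, swapGL_mem_GL2Int, rfl⟩⟩, ?_⟩
    change (((GLn.ofLocal 2 K v swapGL * GLn.ofLocal 2 K v (heckeLocalDiag ϖ hϖ0) :
      GL (Fin 2) (AdeleRing (𝓞 K) K)) : GL (Fin 2) (AdeleRing (𝓞 K) K) ⧸ U)) = _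
    rw [heckeLocalRep_none_eq, map_mul, map_mul, map_inv]
    refine (QuotientGroup.eq.2 ?_).symm
    have e : (GLn.ofLocal 2 K v swapGL * GLn.ofLocal 2 K v (heckeLocalDiag ϖ hϖ0) *
        (GLn.ofLocal 2 K v swapGL)⁻¹)⁻¹ * (GLn.ofLocal 2 K v swapGL * GLn.ofLocal 2 K v (heckeLocalDiag ϖ hϖ0)) =
        GLn.ofLocal 2 K v swapGL := by
      group
    rw [e]
    exact hU1 ⟨_, swapGL_mem_GL2Int, rfl⟩

include hU2 hϖ hbinj in
/-- Distinct representatives give distinct cosets (`InjOn`). [folklore] -/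
theorem ofLocal_heckeLocalRep_injOn {i j : Option ι}
    (h : ((GLn.ofLocal 2 K v (heckeLocalRep ϖ b hϖ0 i) : GL (Fin 2) (AdeleRing (𝓞 K) K)) :
        GL (Fin 2) (AdeleRing (𝓞 K) K) ⧸ U) = (GLn.ofLocal 2 K v (heckeLocalRep ϖ b hϖ0 j) : _)) :
    i = j := by
  rw [QuotientGroup.eq] at h
  have h' := hU2 _ h
  rw [← map_inv, ← map_mul, GLn.map_adeleEval_ofLocal] at h'
  exact heckeLocalRep_eq_of_inv_mul_mem ϖ b hϖ0 hϖ hbinj h'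

include hU1 hU2 hU3 hϖ hb in
/-- Every coset in `U · (t U)` is some `(ofLocal y_j) U` (`SurjOn`): for `u ∈ U` write
`u = k' ℓ` with `ℓ = ofLocal u_v` and `k'` trivial at `v` (`hU3`); choose `j` by the local row
reduction (`exists_heckeLocalRep_inv_mul_mul_mem`); then `y_j⁻¹ u t = k' · ofLocal(y_j⁻¹ u_v t_v) ∈ U`. [folklore] -/
theorem exists_ofLocal_heckeLocalRep_eq (hbint : ∀ i, Valued.v (b i) ≤ 1) {u : GL (Fin 2) (AdeleRing (𝓞 K) K)}
    (hu : u ∈ U) :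
    ∃ j, ((GLn.ofLocal 2 K v (heckeLocalRep ϖ b hϖ0 j) : GL (Fin 2) (AdeleRing (𝓞 K) K)) :
        GL (Fin 2) (AdeleRing (𝓞 K) K) ⧸ U) =
      ((u * GLn.ofLocal 2 K v (heckeLocalDiag ϖ hϖ0) : GL (Fin 2) (AdeleRing (𝓞 K) K)) : _) := by
  set uv := Matrix.GeneralLinearGroup.map (AdelicGroupData.adeleEval K v) u with huv
  obtain ⟨j, hj⟩ := exists_heckeLocalRep_inv_mul_mul_mem ϖ b hϖ0 hϖ hbint hb (hU2 u hu)
  refine ⟨j, ?_⟩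
  rw [QuotientGroup.eq]
  set k' := u * (GLn.ofLocal 2 K v uv)⁻¹ with hk'
  have hk'U : k' ∈ U := hU3 u hu
  have hk'v : Matrix.GeneralLinearGroup.map (AdelicGroupData.adeleEval K v) k' = 1 := by
    rw [hk', map_mul, map_inv, GLn.map_adeleEval_ofLocal, ← huv, mul_inv_cancel]
  have hu' : u = k' * GLn.ofLocal 2 K v uv := by rw [hk', inv_mul_cancel_right]
  have comm := GLn.ofLocal_mul_eq_mul_ofLocal_of_toLocal_eq_one (n := 2) (heckeLocalRep ϖ b hϖ0 j)⁻¹ hk'v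
  have key : (GLn.ofLocal 2 K v (heckeLocalRep ϖ b hϖ0 j))⁻¹ * (u * GLn.ofLocal 2 K v (heckeLocalDiag ϖ hϖ0)) =
      k' * GLn.ofLocal 2 K v ((heckeLocalRep ϖ b hϖ0 j)⁻¹ * uv * heckeLocalDiag ϖ hϖ0) := by
    calc (GLn.ofLocal 2 K v (heckeLocalRep ϖ b hϖ0 j))⁻¹ * (u * GLn.ofLocal 2 K v (heckeLocalDiag ϖ hϖ0))
        = (GLn.ofLocal 2 K v (heckeLocalRep ϖ b hϖ0 j)⁻¹ * k') *
            (GLn.ofLocal 2 K v uv * GLn.ofLocal 2 K v (heckeLocalDiag ϖ hϖ0)) := by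
          rw [hu', map_inv]; simp only [mul_assoc]
      _ = (k' * GLn.ofLocal 2 K v (heckeLocalRep ϖ b hϖ0 j)⁻¹) *
            (GLn.ofLocal 2 K v uv * GLn.ofLocal 2 K v (heckeLocalDiag ϖ hϖ0)) := by rw [comm]
      _ = k' * GLn.ofLocal 2 K v ((heckeLocalRep ϖ b hϖ0 j)⁻¹ * uv * heckeLocalDiag ϖ hϖ0) := by
          rw [map_mul, map_mul]; simp only [mul_assoc]
  rw [key]
  exact mul_mem hk'U (hU1 ⟨_, hj, rfl⟩)

include hU1 hU2 hU3 hϖ hb hbinj in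
/-- **`U t U = ⊔ⱼ (ofLocal yⱼ) U`**: for a level `U ≤ GL₂(𝔸_K)` which contains `GL₂(𝒪_v)`, whose
`v`-components are integral and which is stable under removing the `v`-component, the adelic
images of the local representatives `y_j` (`j ∈ ι ⊔ {∞}`) form a complete system of
representatives of the `U`-orbit of `t U`, `t = diag(ϖ, 1)` at `v` — the hypothesis of the trunk's
`heckeOperator_apply_eq_sum` (the local decomposition is Bump (1997), (6.4), p. 494; Gelbart (1975),
proof of Lemma 3.7, p. 31; the passage to `GL₂(𝔸)` is the place-by-place check below). [cite: Bump1997, §4.6, (6.4), p. 494] -/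
theorem bijOn_ofLocal_heckeLocalRep (hbint : ∀ i, Valued.v (b i) ≤ 1) :
    Set.BijOn (fun y : GL (Fin 2) (AdeleRing (𝓞 K) K) => (y : GL (Fin 2) (AdeleRing (𝓞 K) K) ⧸ U))
      (Set.range fun j : Option ι => GLn.ofLocal 2 K v (heckeLocalRep ϖ b hϖ0 j))
      (MulAction.orbit U ((GLn.ofLocal 2 K v (heckeLocalDiag ϖ hϖ0) : GL (Fin 2) (AdeleRing (𝓞 K) K)) :
        GL (Fin 2) (AdeleRing (𝓞 K) K) ⧸ U)) := by
  refine ⟨?_, ?_, ?_⟩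
  · rintro _ ⟨j, rfl⟩
    exact ofLocal_heckeLocalRep_mem_orbit hU1 hϖ0 b hbint j
  · rintro _ ⟨i, rfl⟩ _ ⟨j, rfl⟩ h
    rw [ofLocal_heckeLocalRep_injOn hU2 hϖ0 hϖ b hbinj h]
  · rintro _ ⟨u, rfl⟩
    obtain ⟨j, hj⟩ := exists_ofLocal_heckeLocalRep_eq hU1 hU2 hU3 hϖ0 hϖ b hb hbint u.2
    exact ⟨_, ⟨j, rfl⟩, hj⟩

end GlobalCosets

end Literature.NumberTheory.Automorphic

namespace Literature.NumberTheory.Automorphic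

/-! ### The Hecke element `t_{v,1}` is `ofLocal diag(ϖ, 1)` -/

section HeckeDiag

variable {K : Type} [Field K] [NumberField K] {v : HeightOneSpectrum (𝓞 K)}

/-- The local matrix `diag(ϖ, 1)` is the `glDiagonal` of `(ϖ, 1)`. [folklore] -/
theorem heckeLocalDiag_eq_glDiagonal (ϖ : (v.adicCompletion K)ˣ) :
    heckeLocalDiag (ϖ : v.adicCompletion K) ϖ.ne_zero =
      glDiagonal 2 (v.adicCompletion K) (fun k => if (k : ℕ) < 1 then ϖ else 1) := by
  ext i j
  rw [coe_heckeLocalDiag, coe_glDiagonal, Matrix.diagonal_apply]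
  fin_cases i <;> fin_cases j <;> simp

/-- **`t_{v,1} = ofLocal diag(ϖ, 1)`**: the trunk's Hecke element at `v` is the adelic image of
the local matrix `diag(ϖ, 1) ∈ GL₂(K_v)` (`heckeDiagAt_eq_ofLocal_glDiagonal` of
`UnramifiedHeckeScalars`). [folklore] -/
theorem heckeDiagAt_two_one_eq_ofLocal (ϖ : (v.adicCompletion K)ˣ) :
    heckeDiagAt 2 K v ϖ 1 = GLn.ofLocal 2 K v (heckeLocalDiag (ϖ : v.adicCompletion K) ϖ.ne_zero) := by
  rw [heckeDiagAt_eq_ofLocal_glDiagonal, heckeLocalDiag_eq_glDiagonal]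

end HeckeDiag

/-! ### The level `K(𝔫)` satisfies the local hypotheses at `v ∤ 𝔫` -/

section LevelK

variable {K : Type} [Field K] [NumberField K] {v : HeightOneSpectrum (𝓞 K)}

/-- `ofLocal g ∈ K^max` for `g ∈ GL₂(𝒪_v)` (`isMaximalAt_glIntegralLevel`). [folklore] -/
theorem ofLocal_mem_glIntegralLevel {n : ℕ} {g : GL (Fin n) (v.adicCompletion K)}
    (hg : g ∈ valuedCongruenceSubgroup (Fin n) (1 : WithZero (Multiplicative ℤ))) :
    GLn.ofLocal n K v g ∈ glIntegralLevel n K :=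
  isMaximalAt_glIntegralLevel n K v ⟨g, hg, rfl⟩

/-- **`K(𝔫)` at `v ∤ 𝔫`**: (U1) it contains `GL₂(𝒪_v)`, (U2) its `v`-components are integral, and
(U3) it is stable under removal of the `v`-component, `u ↦ u · ofLocal(u_v)⁻¹`. [folklore] -/
theorem principalCongruenceLevel_local_hyps {n : ℕ} {𝔫 : Ideal (𝓞 K)} (h𝔫 : 𝔫 ≠ 0) (hv : ¬ v.asIdeal ∣ 𝔫) :
    ((valuedCongruenceSubgroup (Fin n) (1 : WithZero (Multiplicative ℤ))).map (GLn.ofLocal n K v) ≤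
        principalCongruenceLevel n K 𝔫) ∧
      (∀ u ∈ principalCongruenceLevel n K 𝔫, Matrix.GeneralLinearGroup.map (AdelicGroupData.adeleEval K v) u ∈
        valuedCongruenceSubgroup (Fin n) (1 : WithZero (Multiplicative ℤ))) ∧
      (∀ u ∈ principalCongruenceLevel n K 𝔫,
        u * (GLn.ofLocal n K v (Matrix.GeneralLinearGroup.map (AdelicGroupData.adeleEval K v) u))⁻¹ ∈
          principalCongruenceLevel n K 𝔫) := by
  have hrad : idealRadius K v 𝔫 = 1 := idealRadius_eq_one_of_not_dvd h𝔫 hv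
  refine ⟨isMaximalAt_principalCongruenceLevel n K v h𝔫 hv, fun u hu => ?_, fun u hu => ?_⟩
  · have := ((mem_principalCongruenceLevel_iff.1 hu).2 v)
    rwa [hrad] at this
  · rw [mem_principalCongruenceLevel_iff] at hu ⊢
    obtain ⟨hint, hloc⟩ := hu
    have huv : Matrix.GeneralLinearGroup.map (AdelicGroupData.adeleEval K v) u ∈
        valuedCongruenceSubgroup (Fin n) (1 : WithZero (Multiplicative ℤ)) := by
      have := hloc v; rwa [hrad] at this
    refine ⟨mul_mem hint (inv_mem (ofLocal_mem_glIntegralLevel huv)), fun w => ?_⟩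
    change Matrix.GeneralLinearGroup.map (AdelicGroupData.adeleEval K w) _ ∈ _
    rw [map_mul, map_inv]
    by_cases hw : w = v
    · subst hw
      rw [GLn.map_adeleEval_ofLocal, mul_inv_cancel]
      exact one_mem _
    · rw [GLn.map_adeleEval_ofLocal_of_ne hw, inv_one, mul_one]
      exact hloc w

end LevelK

/-! ### Residue representatives `0, 1, …, p - 1` in `ℤ_p` -/

section RatResidues

open Rat.HeightOneSpectrum

variable (v : HeightOneSpectrum (𝓞 ℚ))

/-- Valuations of principal elements of `ℚ_p` (Mathlib `valuedAdicCompletion_eq_valuation'`, restated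
for the `algebraMap` spelling of the coercion). [folklore] -/
theorem Rat.valued_algebraMap (q : ℚ) : Valued.v (algebraMap ℚ (v.adicCompletion ℚ) q) = v.valuation ℚ q :=
  valuedAdicCompletion_eq_valuation' v q

/-- The valuation of a natural number at `v` is `< 1` iff the prime `p_v` divides it. [folklore] -/
theorem Rat.valued_algebraMap_natCast_lt_one_iff (n : ℕ) :
    Valued.v (algebraMap ℚ (v.adicCompletion ℚ) (n : ℚ)) < 1 ↔ (natGenerator v : ℕ) ∣ n := by
  rw [Rat.valued_algebraMap, ← map_natCast (algebraMap (𝓞 ℚ) ℚ), valuation_of_algebraMap,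
    intValuation_lt_one_iff_mem, Rat.asIdeal_eq_span_natGenerator', Ideal.mem_span_singleton]
  constructor
  · rintro ⟨c, hc⟩
    have hc' := congrArg Rat.ringOfIntegersEquiv hc
    rw [map_mul, map_natCast, map_natCast] at hc'
    exact Int.natCast_dvd_natCast.1 ⟨_, hc'⟩
  · rintro ⟨c, rfl⟩
    exact ⟨c, Nat.cast_mul _ _⟩

/-- The valuation of an integer at `v` is `< 1` iff `p_v` divides it. [folklore] -/
theorem Rat.valued_algebraMap_intCast_lt_one_iff (z : ℤ) :
    Valued.v (algebraMap ℚ (v.adicCompletion ℚ) (z : ℚ)) < 1 ↔ ((natGenerator v : ℕ) : ℤ) ∣ z := by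
  rw [Int.natCast_dvd]
  rcases Int.natAbs_eq z with h | h
  · conv_lhs => rw [h]
    rw [Int.cast_natCast, Rat.valued_algebraMap_natCast_lt_one_iff]
  · conv_lhs => rw [h]
    rw [Int.cast_neg, Int.cast_natCast, map_neg, Valuation.map_neg, Rat.valued_algebraMap_natCast_lt_one_iff]

/-- The principal elements `algebraMap ℚ ℚ_p n`, `n ∈ ℕ`, are integral. [folklore] -/
theorem Rat.valued_algebraMap_natCast_le_one (n : ℕ) : Valued.v (algebraMap ℚ (v.adicCompletion ℚ) (n : ℚ)) ≤ 1 := by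
  rw [Rat.valued_algebraMap, ← map_natCast (algebraMap (𝓞 ℚ) ℚ), valuation_of_algebraMap]
  exact intValuation_le_one v _

/-- **`0, …, p-1` is a complete residue system of `ℤ_p`**: every `x ∈ ℤ_p` is congruent mod the
maximal ideal to some `i < p` (approximate `x` by a global integer, `AdicCompletionCompact`, and
reduce mod `p`). [folklore] -/
theorem Rat.exists_valued_sub_algebraMap_natCast_lt_one (x : v.adicCompletion ℚ) (hx : Valued.v x ≤ 1) :
    ∃ i : Fin (natGenerator v), Valued.v (x - algebraMap ℚ (v.adicCompletion ℚ) ((i : ℕ) : ℚ)) < 1 := by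
  have hp : 0 < (natGenerator v : ℕ) := (prime_natGenerator v).pos
  have hpz : (0 : ℤ) < (natGenerator v : ℕ) := by exact_mod_cast hp
  obtain ⟨a, ha⟩ := exists_ringOfIntegers_valued_sub_lt_one ℚ v ⟨x, (mem_adicCompletionIntegers _ _ _).2 hx⟩
  set z : ℤ := Rat.ringOfIntegersEquiv a with hz
  have haz : (algebraMap (𝓞 ℚ) ℚ a : ℚ) = z := by rw [hz, Rat.ringOfIntegersEquiv_apply_coe]
  set i : ℕ := (z % (natGenerator v : ℕ)).toNat with hi
  have hinn : 0 ≤ z % (natGenerator v : ℕ) := Int.emod_nonneg z hpz.ne'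
  have hi_lt : i < natGenerator v := by
    have h1 := Int.emod_lt_of_pos z hpz
    omega
  refine ⟨⟨i, hi_lt⟩, ?_⟩
  have hzi : ((natGenerator v : ℕ) : ℤ) ∣ z - i := by
    rw [hi, Int.toNat_of_nonneg hinn]
    exact (Int.mod_modEq z _).dvd
  have h2 : Valued.v (algebraMap ℚ (v.adicCompletion ℚ) (z : ℚ) - algebraMap ℚ (v.adicCompletion ℚ) ((i : ℕ) : ℚ)) < 1 := by
    rw [← map_sub, ← Int.cast_natCast, ← Int.cast_sub, Rat.valued_algebraMap_intCast_lt_one_iff]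
    exact hzi
  have h1 : Valued.v (x - algebraMap ℚ (v.adicCompletion ℚ) (z : ℚ)) < 1 := by
    rw [← Valuation.map_neg, neg_sub, ← haz]
    exact ha
  calc Valued.v (x - algebraMap ℚ (v.adicCompletion ℚ) (((i : ℕ) : ℚ)))
      = Valued.v ((x - algebraMap ℚ (v.adicCompletion ℚ) (z : ℚ)) +
          (algebraMap ℚ (v.adicCompletion ℚ) (z : ℚ) - algebraMap ℚ (v.adicCompletion ℚ) ((i : ℕ) : ℚ))) := by
        congr 1; ring
    _ ≤ max (Valued.v (x - algebraMap ℚ (v.adicCompletion ℚ) (z : ℚ)))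
          (Valued.v (algebraMap ℚ (v.adicCompletion ℚ) (z : ℚ) - algebraMap ℚ (v.adicCompletion ℚ) ((i : ℕ) : ℚ))) :=
        Valued.v.map_add _ _
    _ < 1 := max_lt h1 h2

/-- Distinct `i, j < p` are incongruent mod the maximal ideal of `ℤ_p`. [folklore] -/
theorem Rat.fin_eq_of_valued_sub_lt_one {i j : Fin (natGenerator v)}
    (h : Valued.v (algebraMap ℚ (v.adicCompletion ℚ) ((i : ℕ) : ℚ) -
      algebraMap ℚ (v.adicCompletion ℚ) ((j : ℕ) : ℚ)) < 1) : i = j := by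
  rw [← map_sub, ← Int.cast_natCast, ← Int.cast_natCast (j : ℕ), ← Int.cast_sub,
    Rat.valued_algebraMap_intCast_lt_one_iff] at h
  have hlt : |((i : ℕ) : ℤ) - ((j : ℕ) : ℤ)| < ((natGenerator v : ℕ) : ℤ) := by
    rw [abs_sub_lt_iff]
    have hi := i.2
    have hj := j.2
    omega
  have h0 := Int.eq_zero_of_abs_lt_dvd h hlt
  apply Fin.ext
  omega

end RatResidues

end Literature.NumberTheory.Automorphic

namespace Literature.NumberTheory.Automorphic

/-! ### The level `K₁(𝔫)` place by place, and the adelic level `{1} × K₁(𝔫)` -/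

section LocalK1

variable {K : Type} [Field K] [NumberField K]

/-- The **local conditions of `K₁(𝔫)` at `w`** on `m ∈ GL₂(K_w)`: `m, m⁻¹` integral, the lower
left entries of `m, m⁻¹` and `m₁₁ - 1` of valuation `≤ |𝔫|_w` (so: `GL₂(𝒪_w)` for `w ∤ 𝔫`). [folklore] -/
def IsLocK1 (w : HeightOneSpectrum (𝓞 K)) (𝔫 : Ideal (𝓞 K)) (m : GL (Fin 2) (w.adicCompletion K)) : Prop :=
  (∀ i j, Valued.v ((m : Matrix (Fin 2) (Fin 2) (w.adicCompletion K)) i j) ≤ 1) ∧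
    (∀ i j, Valued.v (((m⁻¹ : GL (Fin 2) (w.adicCompletion K)) : Matrix (Fin 2) (Fin 2) (w.adicCompletion K)) i j) ≤ 1) ∧
    Valued.v ((m : Matrix (Fin 2) (Fin 2) (w.adicCompletion K)) 1 0) ≤ idealRadius K w 𝔫 ∧
    Valued.v (((m⁻¹ : GL (Fin 2) (w.adicCompletion K)) : Matrix (Fin 2) (Fin 2) (w.adicCompletion K)) 1 0) ≤
      idealRadius K w 𝔫 ∧
    Valued.v ((m : Matrix (Fin 2) (Fin 2) (w.adicCompletion K)) 1 1 - 1) ≤ idealRadius K w 𝔫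

/-- `1` satisfies the local conditions. [folklore] -/
theorem isLocK1_one (w : HeightOneSpectrum (𝓞 K)) (𝔫 : Ideal (𝓞 K)) : IsLocK1 w 𝔫 (1 : GL (Fin 2) (w.adicCompletion K)) := by
  refine ⟨fun i j => ?_, fun i j => ?_, ?_, ?_, ?_⟩
  · rw [Units.val_one, Matrix.one_apply]; split_ifs <;> simp
  · rw [inv_one, Units.val_one, Matrix.one_apply]; split_ifs <;> simp
  · rw [Units.val_one, Matrix.one_apply_ne (by decide), Valuation.map_zero]; exact zero_le
  · rw [inv_one, Units.val_one, Matrix.one_apply_ne (by decide), Valuation.map_zero]; exact zero_le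
  · rw [Units.val_one, Matrix.one_apply_eq, sub_self, Valuation.map_zero]; exact zero_le

/-- At a place `w ∤ 𝔫` (`|𝔫|_w = 1`) every element of `GL₂(𝒪_w)` satisfies the local conditions. [folklore] -/
theorem isLocK1_of_mem_valuedCongruenceSubgroup_one {w : HeightOneSpectrum (𝓞 K)} {𝔫 : Ideal (𝓞 K)}
    (hrad : idealRadius K w 𝔫 = 1) {m : GL (Fin 2) (w.adicCompletion K)}
    (hm : m ∈ valuedCongruenceSubgroup (Fin 2) (1 : WithZero (Multiplicative ℤ))) : IsLocK1 w 𝔫 m := by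
  obtain ⟨h1, h2, h3⟩ := hm
  rw [IsLocK1, hrad]
  refine ⟨h1, h2, h1 1 0, h2 1 0, ?_⟩
  have := h3 1 1
  rwa [Matrix.sub_apply, Matrix.one_apply_eq] at this

/-- The local conditions imply membership in `GL₂(𝒪_w)`. [folklore] -/
theorem IsLocK1.mem_valuedCongruenceSubgroup_one {w : HeightOneSpectrum (𝓞 K)} {𝔫 : Ideal (𝓞 K)}
    {m : GL (Fin 2) (w.adicCompletion K)} (hm : IsLocK1 w 𝔫 m) :
    m ∈ valuedCongruenceSubgroup (Fin 2) (1 : WithZero (Multiplicative ℤ)) := by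
  obtain ⟨h1, h2, -, -, -⟩ := hm
  refine ⟨h1, h2, fun i j => ?_⟩
  rw [Matrix.sub_apply]
  refine (Valuation.map_sub _ _ _).trans (max_le (h1 i j) ?_)
  rw [Matrix.one_apply]; split_ifs <;> simp

/-- Entries of `map (finiteAdeleEval K w) x` are the `w`-components of the entries of `x`. [folklore] -/
theorem coe_map_finiteAdeleEval_apply (w : HeightOneSpectrum (𝓞 K)) (x : GL (Fin 2) (FiniteAdeleRing (𝓞 K) K)) (i j : Fin 2) :
    ((Matrix.GeneralLinearGroup.map (AdelicGroupData.finiteAdeleEval K w) x : GL (Fin 2) (w.adicCompletion K)) :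
      Matrix (Fin 2) (Fin 2) (w.adicCompletion K)) i j = (x : Matrix (Fin 2) (Fin 2) (FiniteAdeleRing (𝓞 K) K)) i j w :=
  rfl

/-- **`K₁(𝔫)` is defined place by place**: `x ∈ K₁(𝔫)` iff every local component `x_w` satisfies
the local conditions `IsLocK1 w 𝔫`. [folklore] -/
theorem mem_gammaOneFiniteLevel_iff_forall {𝔫 : Ideal (𝓞 K)} {x : GL (Fin 2) (FiniteAdeleRing (𝓞 K) K)} :
    x ∈ gammaOneFiniteLevel K 𝔫 ↔
      ∀ w, IsLocK1 w 𝔫 (Matrix.GeneralLinearGroup.map (AdelicGroupData.finiteAdeleEval K w) x) := by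
  simp only [mem_gammaOneFiniteLevel_iff, mem_gammaZeroFiniteLevel_iff, mem_eichlerOrder_iff,
    mem_integralFiniteAdeles_iff, mem_levelIdeal_iff, mem_adicCompletionIntegers, IsLocK1, ← map_inv,
    coe_map_finiteAdeleEval_apply]
  have hsub : ∀ w, ((x : Matrix (Fin 2) (Fin 2) (FiniteAdeleRing (𝓞 K) K)) 1 1 - 1) w =
      (x : Matrix (Fin 2) (Fin 2) (FiniteAdeleRing (𝓞 K) K)) 1 1 w - 1 := fun w => rfl
  simp only [hsub]
  constructor
  · rintro ⟨⟨⟨ha, hb⟩, hc, hd⟩, he⟩ w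
    exact ⟨fun i j => ha i j w, fun i j => hc i j w, hb w, hd w, he w⟩
  · intro h
    exact ⟨⟨⟨fun i j w => (h w).1 i j, fun w => (h w).2.2.1⟩, fun i j w => (h w).2.1 i j, fun w => (h w).2.2.2.1⟩,
      fun w => (h w).2.2.2.2⟩

variable (K) in
/-- The adelic level **`{1} × K₁(𝔫) ≤ GL₂(𝔸_K)`**: trivial archimedean part, finite part in `K₁(𝔫)`
(the right-invariance group of the adelic lift `φ_f`; Gelbart (1975), Prop. 3.1 (ii)). [folklore] -/
def gammaOneLevel (𝔫 : Ideal (𝓞 K)) : Subgroup (GL (Fin 2) (AdeleRing (𝓞 K) K)) :=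
  (GLn.fstHom 2 K).ker ⊓ (gammaOneFiniteLevel K 𝔫).comap (GLn.sndHom 2 K)

/-- Membership in `{1} × K₁(𝔫)`. [folklore] -/
theorem mem_gammaOneLevel_iff {𝔫 : Ideal (𝓞 K)} {u : GL (Fin 2) (AdeleRing (𝓞 K) K)} :
    u ∈ gammaOneLevel K 𝔫 ↔ GLn.fstHom 2 K u = 1 ∧ GLn.sndHom 2 K u ∈ gammaOneFiniteLevel K 𝔫 :=
  Iff.rfl

/-- Local components through the finite part: `(x_f)_w = x_w`. [folklore] -/
theorem map_finiteAdeleEval_sndHom (w : HeightOneSpectrum (𝓞 K)) (x : GL (Fin 2) (AdeleRing (𝓞 K) K)) :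
    Matrix.GeneralLinearGroup.map (AdelicGroupData.finiteAdeleEval K w) (GLn.sndHom 2 K x) =
      Matrix.GeneralLinearGroup.map (AdelicGroupData.adeleEval K w) x :=
  rfl

/-- **`{1} × K₁(𝔫)` at `v ∤ 𝔫`**: (U1) it contains `GL₂(𝒪_v)`, (U2) its `v`-components are integral,
(U3) it is stable under removal of the `v`-component. [folklore] -/
theorem gammaOneLevel_local_hyps {v : HeightOneSpectrum (𝓞 K)} {𝔫 : Ideal (𝓞 K)} (h𝔫 : 𝔫 ≠ 0) (hv : ¬ v.asIdeal ∣ 𝔫) :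
    ((valuedCongruenceSubgroup (Fin 2) (1 : WithZero (Multiplicative ℤ))).map (GLn.ofLocal 2 K v) ≤
        gammaOneLevel K 𝔫) ∧
      (∀ u ∈ gammaOneLevel K 𝔫, Matrix.GeneralLinearGroup.map (AdelicGroupData.adeleEval K v) u ∈
        valuedCongruenceSubgroup (Fin 2) (1 : WithZero (Multiplicative ℤ))) ∧
      (∀ u ∈ gammaOneLevel K 𝔫,
        u * (GLn.ofLocal 2 K v (Matrix.GeneralLinearGroup.map (AdelicGroupData.adeleEval K v) u))⁻¹ ∈
          gammaOneLevel K 𝔫) := by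
  have hrad : idealRadius K v 𝔫 = 1 := idealRadius_eq_one_of_not_dvd h𝔫 hv
  refine ⟨?_, fun u hu => ?_, fun u hu => ?_⟩
  · rintro _ ⟨g, hg, rfl⟩
    rw [mem_gammaOneLevel_iff, Literature.NumberTheory.Automorphic.GLn.fstHom_ofLocal, mem_gammaOneFiniteLevel_iff_forall]
    refine ⟨rfl, fun w => ?_⟩
    rw [map_finiteAdeleEval_sndHom]
    by_cases hw : w = v
    · subst hw
      rw [GLn.map_adeleEval_ofLocal]
      exact isLocK1_of_mem_valuedCongruenceSubgroup_one hrad hg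
    · rw [GLn.map_adeleEval_ofLocal_of_ne hw]
      exact isLocK1_one w 𝔫
  · rw [mem_gammaOneLevel_iff, mem_gammaOneFiniteLevel_iff_forall] at hu
    have := hu.2 v
    rw [map_finiteAdeleEval_sndHom] at this
    exact this.mem_valuedCongruenceSubgroup_one
  · rw [mem_gammaOneLevel_iff, mem_gammaOneFiniteLevel_iff_forall] at hu ⊢
    obtain ⟨hu1, hu2⟩ := hu
    refine ⟨by rw [map_mul, map_inv, hu1, Literature.NumberTheory.Automorphic.GLn.fstHom_ofLocal, inv_one, mul_one], fun w => ?_⟩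
    rw [map_finiteAdeleEval_sndHom, map_mul, map_inv]
    by_cases hw : w = v
    · subst hw
      rw [GLn.map_adeleEval_ofLocal, mul_inv_cancel]
      exact isLocK1_one w 𝔫
    · rw [GLn.map_adeleEval_ofLocal_of_ne hw, inv_one, mul_one, ← map_finiteAdeleEval_sndHom]
      exact hu2 w

end LocalK1

/-! ### Sums over coset representatives are invariant under the level -/

section Permutation

variable {G : Type*} [Group G] {U : Subgroup G} {ι : Type*} [Fintype ι]

/-- **Left multiplication by `u ∈ U` permutes a system of representatives of `U t U / U`**: if the
cosets `yᵢ U` (`y` injective on cosets) are exactly the `U`-orbit of `t U`, then for every `u ∈ U`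
there is a permutation `σ` of the index set and `kᵢ ∈ U` with `u yᵢ = y_{σ i} kᵢ`. [folklore] -/
theorem exists_perm_of_bijOn_cosets (y : ι → G) (t : G)
    (hbij : Set.BijOn (fun g : G => (g : G ⧸ U)) (Set.range y) (MulAction.orbit U (t : G ⧸ U)))
    (hinj : Function.Injective y) {u : G} (hu : u ∈ U) :
    ∃ σ : Equiv.Perm ι, ∀ i, ∃ k ∈ U, u * y i = y (σ i) * k := by
  classical
  -- each `u yᵢ U` is again in the orbit, hence some `y_{σ i} U`
  have hex : ∀ i, ∃ j, ((u * y i : G) : G ⧸ U) = (y j : G ⧸ U) := fun i => by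
    have hmem : ((u * y i : G) : G ⧸ U) ∈ MulAction.orbit U (t : G ⧸ U) := by
      have : ((u * y i : G) : G ⧸ U) = (⟨u, hu⟩ : U) • ((y i : G) : G ⧸ U) := rfl
      rw [this]
      exact MulAction.mem_orbit_of_mem_orbit _ (hbij.mapsTo ⟨i, rfl⟩)
    obtain ⟨_, ⟨j, rfl⟩, hj⟩ := hbij.surjOn hmem
    exact ⟨j, hj.symm⟩
  choose σ hσ using hex
  have hσinj : Function.Injective σ := fun i i' h => by
    have h1 : ((u * y i : G) : G ⧸ U) = ((u * y i' : G) : G ⧸ U) := by rw [hσ i, hσ i', h]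
    have h2 : ((y i : G) : G ⧸ U) = ((y i' : G) : G ⧸ U) := by
      rw [QuotientGroup.eq] at h1 ⊢
      simpa [_root_.mul_inv_rev, mul_assoc] using h1
    exact hinj (hbij.injOn ⟨i, rfl⟩ ⟨i', rfl⟩ h2)
  refine ⟨Equiv.ofBijective σ (Finite.injective_iff_bijective.1 hσinj), fun i => ?_⟩
  have h := hσ i
  rw [QuotientGroup.eq] at h
  refine ⟨(y (σ i))⁻¹ * (u * y i), by simpa using U.inv_mem h, ?_⟩
  rw [Equiv.ofBijective_apply, mul_inv_cancel_left]

/-- **Sums of a right-`U`-invariant function over the representatives are `U`-invariant**: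
`∑ᵢ F(g u yᵢ) = ∑ᵢ F(g yᵢ)` for `u ∈ U` (reindex along the permutation of
`exists_perm_of_bijOn_cosets`). [folklore] -/
theorem sum_apply_mul_mul_eq_of_bijOn_cosets {M : Type*} [AddCommMonoid M] (y : ι → G) (t : G)
    (hbij : Set.BijOn (fun g : G => (g : G ⧸ U)) (Set.range y) (MulAction.orbit U (t : G ⧸ U)))
    (hinj : Function.Injective y) (F : G → M) (hF : ∀ (g k : G), k ∈ U → F (g * k) = F g)
    {u : G} (hu : u ∈ U) (g : G) :
    ∑ i, F (g * (u * y i)) = ∑ i, F (g * y i) := by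
  obtain ⟨σ, hσ⟩ := exists_perm_of_bijOn_cosets y t hbij hinj hu
  have h : ∀ i, F (g * (u * y i)) = F (g * y (σ i)) := fun i => by
    obtain ⟨k, hk, hki⟩ := hσ i
    rw [hki, ← mul_assoc, hF _ _ hk]
  simp_rw [h]
  exact Fintype.sum_equiv σ _ _ fun i => rfl

end Permutation

end Literature.NumberTheory.Automorphic
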